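import Literature.MathematicalPhysics.QuantumFieldTheory.Balaban1983to89.B6SchurTorusBound
import Literature.MathematicalPhysics.QuantumFieldTheory.Balaban1983to89.B4Sect5Torus

/-!
# `Balaban1983to89.B6BlockDecayCalculus` — T. Bałaban, *Propagators and renormalization transformations for lattice gauge theories. II*,
# Commun. Math. Phys. **96** (1984) 223–250 [Balaban1984PropagatorsII], Proposition 2.5 p. 246 with [4] = *… I*, CMP **95** (1984) Prop. 1.2
# (1.110) p. 35: the CALCULUS OF BLOCK-LOCALIZED DECAY BOUNDS by which the decay inequalities (1.110) of a COMPOSITE operator — the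
# two-scale `G` in its representation (2.129) — follow from those of its factors: block row-sum decay bounds for linear maps between `ℓ²`
# carriers placed over a pseudo-metric unit lattice, their composition WITHOUT VOLUME FACTORS, sums, adjoints, and the equivalence with the
# printed cube-sup shape of (1.110)

statement-level skeleton of published theorems with citation tags; proofs where landed; nothing here is a claim about the Yang–Mills mass gap

PDF held: `paper:balaban1984-cmp96-propagators-rt-ii` (journal page = PDF page + 222), p. 246 [PDF 24]; `paper:balaban1984-cmp95-propagators-rt-i`
([4], journal page = PDF page + 16), pp. 35–36 [PDF 19–20].  PRINT.  [B6] p. 246 (verbatim, text layer grepped by this seat): *"Proposition 2.5.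
The operator G_□ defined by (2.90) on the torus T_□ (or on the whole lattice ξZ^d) has the representation (2.129) and satisfies all the inequalities
(1.110)–(1.114) of the Proposition 1.2 with a positive constant δ₂ instead of δ₀. This constant depends on d and L only."* — the paper proves the
decay of each FACTOR of (2.129) (H′_j and its derivatives p. 241/246, C^{(j)}_Λ p. 242, C̃^{(j)}_Λ p. 246, G̃_j, H_j via (2.130)–(2.131) and [4])
and leaves the composition to the reader.  [4] p. 35 (verbatim, as quoted in the tree's `B5.Prop12Printed`): *"|(GJ)(x)|, |(∇GJ)(x)|, |(G∇*J)(x)|,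
|(ΔGJ)(x)| ≤ O(1)e^{−δ₀|y−y′|}|J| (1.110) for x ∈ Δ̃(y), supp J ⊂ Δ̃(y′)"*; p. 36: *"The localized inequalities (1.110)–(1.114) imply immediately the
following global inequalities"*.  The same composition mechanism is printed for `H_k = GQ*(QGQ*)⁻¹` in [BalabanImbrieJaffe1985] (7.2.2) p. 325
(*"This inequality is a consequence of Proposition 1.2 and the representation (1.103)"*; tree: `…BIJ85Ineq722Proof`, whose `blockRestr`/`conv_exp_le`
steps this file generalises from square kernels on one carrier to linear maps between different carriers).

CITATION HEADER (lean-in-tree rule) — WHAT IS REPRODUCED.  Phase-2 file of the `lit-balaban` typed skeleton (HOME `run/shared/lean/pub/lit-balaban/`),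
seat **p22 gen 14** (B6 fold owner r03, referee ref-4), FILE 2 of the PROP. 2.5 TWO-LEVEL DECAY programme (file 1 `…B6Repr2129Operator`: (2.129) as
an operator identity); SKELETON row **B6.Prop2.5** (toolkit cell; decl of record untouched).  The calculus (all statements and proofs OURS; the
papers display none of it): carriers are finite index types `ι, κ, μ` placed over a finite pseudo-metric space `(Y, ρ)` (`…B4Sect5Torus.IsPseudoDist`,
lattice sums `…B4Sect5Torus.SumBound ρ K`) by position maps `pι, pκ, pμ`; operators are linear maps between the Euclidean spaces `ℓ²(κ) → ℓ²(ι)` read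
through their matrix entries `f(e_k)_i` (`…B6SchurTorusBound.apply_eq_sum_entry`); a BLOCK ROW-SUM DECAY BOUND of `f` with constant `C` and rate
`δ` is the hypothesis shape `∀ i y, Σ_{k : pκ k = y} |f(e_k)_i| ≤ C·e^{−δρ(pι i, y)}` (no definition is introduced; the shape is spelled out in
every statement).  §1 `abs_apply_le_of_blockBound` (pointwise bound of `f x` from a block bound of `f` and a block profile of `x`), `conv_exp_le_rate`
(`Σ_{y′} e^{−aρ(y,y′)}e^{−bρ(y′,y₀)} ≤ K(a−δ′)·e^{−δ′ρ(y,y₀)}` for `δ′ ≤ b`, `δ′ < a`); §2 **`blockBound_comp`** (composition: constants multiply, one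
lattice-sum factor `K(a − δ′)`, NO fibre-size factor — this is why the two-scale composition is uniform in `L^j`), `blockBound_add/sub/smul/id/
mono`; §3 `blockBound_of_entry` (entry decay `|f(e_k)_i| ≤ Ae^{−δρ(pι i, pκ k)}` with fibres `≤ N` ⇒ block bound `A·N`), `adjoint_entry`,
`blockBound_adjoint_of_entry`; §4 THE PRINTED SHAPE: **`abs_apply_le_of_support`** (block bound ⇒ (1.110)-shape: `supp x` within `r` of `y′`,
`|x| ≤ X` ⇒ `|(fx)_i| ≤ C·K(1)e^{(1+2δ)r}·e^{−δρ(y,y′)}·X` for `pι i` within `r` of `y`) and **`blockBound_of_cubeSup`** ((1.110)-shape ⇒ block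
bound, by testing on sign vectors supported in one fibre), `abs_apply_le_global` (p. 36: local ⇒ global); §5 the unit-torus instance of record:
`(Tor M, |rep x − rep y|_T)` is a pseudo-metric space with the uniform profile `K_{d+1}(a)` (`torusDist_isPseudoDist`, `torusDist_sumBound`; b05's
`sum_exp_torusSupNorm_sub_rep_le` BY NAME).  IMPORTS BY NAME, restating nothing.  THEOREMS ONLY (no definition, no `def … : Prop`); standard
axioms.  HONEST SCOPE: finite-dimensional bookkeeping inequalities; no operator of the papers appears in this file (the instances — `C^{(j)}_Λ`,
`C̃^{(j)}_Λ`, `Q_j`, `H_j`, `∂H′_j`, `G_j`, and the assembly for the two-scale `G` of `tsV1` — are the next files of the programme); constants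
ours; NOT summit progress.  Unit `lit-balaban-p22` (gen 14), 2026-08-22.
-/

noncomputable section

open scoped InnerProductSpace BigOperators
open Finset

namespace Literature.MathematicalPhysics.QuantumFieldTheory.Balaban1983to89.B6BlockDecayCalculus

open B4Sect5Torus (IsPseudoDist SumBound)
open B6SchurTorusBound (eq_sum_single apply_eq_sum_entry)
open B5Prop11Plancherel (Tor)
open B4TorusKernel.MultiPeriod (torusSupNorm)
open B4Sect5Proof (latticeConst latticeConst_nonneg)
open B6LowerBound2153Torus (rep)
open B5Hk163TorusHolderRate (sum_exp_torusSupNorm_sub_rep_le)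
open B6Cov2110WeightV1 (torusSupNorm_neg torusSupNorm_zero torusSupNorm_sub_le)

/-! ## §1  Pointwise bounds from block bounds; the lattice convolution at a prescribed rate -/

section Abstract

variable {Y : Type*} {ρ : Y → Y → ℝ} {KY : ℝ → ℝ}
variable {ι κ μ : Type} [Fintype κ] [DecidableEq κ]

/-- `|(fx)_i| ≤ Σ_k |f(e_k)_i|·|x_k|`. [cite: Balaban1984PropagatorsI, (1.110) p.35 (bookkeeping, ours)] -/
theorem abs_apply_le_sum (f : EuclideanSpace ℝ κ →ₗ[ℝ] EuclideanSpace ℝ ι) (x : EuclideanSpace ℝ κ) (i : ι) :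
    |f x i| ≤ ∑ k, |f (EuclideanSpace.single k (1 : ℝ)) i| * |x k| := by
  rw [apply_eq_sum_entry]
  exact (Finset.abs_sum_le_sum_abs _ _).trans (le_of_eq (Finset.sum_congr rfl fun k _ => abs_mul _ _))

/-- **pointwise bound of `fx` from a block row-sum bound of `f` and a block profile of `x`**: if `Σ_{k : pκ k = y}|f(e_k)_i| ≤ Ce^{−δρ(pι i, y)}`
and `|x_k| ≤ g(pκ k)` with `g ≥ 0`, then `|(fx)_i| ≤ C·Σ_y e^{−δρ(pι i, y)}g(y)`. [cite: Balaban1984PropagatorsI, (1.110) p.35 (bookkeeping, ours)] -/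
theorem abs_apply_le_of_blockBound [Fintype Y] [DecidableEq Y] (f : EuclideanSpace ℝ κ →ₗ[ℝ] EuclideanSpace ℝ ι) (pι : ι → Y) (pκ : κ → Y) {C δ : ℝ}
    (hf : ∀ (i : ι) (y : Y), ∑ k ∈ univ.filter (fun k => pκ k = y), |f (EuclideanSpace.single k (1 : ℝ)) i| ≤ C * Real.exp (-(δ * ρ (pι i) y)))
    (x : EuclideanSpace ℝ κ) (g : Y → ℝ) (hg : ∀ y, 0 ≤ g y) (hx : ∀ k, |x k| ≤ g (pκ k)) (i : ι) :
    |f x i| ≤ C * ∑ y, Real.exp (-(δ * ρ (pι i) y)) * g y := by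
  calc |f x i| ≤ ∑ k, |f (EuclideanSpace.single k (1 : ℝ)) i| * |x k| := abs_apply_le_sum f x i
    _ ≤ ∑ k, |f (EuclideanSpace.single k (1 : ℝ)) i| * g (pκ k) :=
        Finset.sum_le_sum fun k _ => mul_le_mul_of_nonneg_left (hx k) (abs_nonneg _)
    _ = ∑ y, ∑ k ∈ univ.filter (fun k => pκ k = y), |f (EuclideanSpace.single k (1 : ℝ)) i| * g (pκ k) :=
        (Finset.sum_fiberwise univ pκ _).symm
    _ = ∑ y, (∑ k ∈ univ.filter (fun k => pκ k = y), |f (EuclideanSpace.single k (1 : ℝ)) i|) * g y := by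
        refine Finset.sum_congr rfl fun y _ => ?_
        rw [Finset.sum_mul]
        refine Finset.sum_congr rfl fun k hk => ?_
        rw [(Finset.mem_filter.mp hk).2]
    _ ≤ ∑ y, C * Real.exp (-(δ * ρ (pι i) y)) * g y :=
        Finset.sum_le_sum fun y _ => mul_le_mul_of_nonneg_right (hf i y) (hg y)
    _ = C * ∑ y, Real.exp (-(δ * ρ (pι i) y)) * g y := by
        rw [Finset.mul_sum]
        exact Finset.sum_congr rfl fun y _ => by ring

/-- **lattice convolution of exponentials at a prescribed output rate**: `Σ_{y′} e^{−aρ(y,y′)}e^{−bρ(y′,y₀)} ≤ K(a − δ′)·e^{−δ′ρ(y,y₀)}` whenever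
`0 ≤ δ′ ≤ b` and `δ′ < a` (triangle inequality; the tree's `…BIJ85Ineq722Proof.conv_exp_le` is the case `δ′ = b/2`).
[cite: BalabanImbrieJaffe1985, (7.2.2) p.325 (the summation over the intermediate unit site; statement ours)] -/
theorem conv_exp_le_rate [Fintype Y] (hρ : IsPseudoDist ρ) (hK : SumBound ρ KY) {a b δ' : ℝ} (hδ'0 : 0 ≤ δ') (hδ'b : δ' ≤ b) (hδ'a : δ' < a)
    (y y₀ : Y) :
    ∑ y', Real.exp (-(a * ρ y y')) * Real.exp (-(b * ρ y' y₀)) ≤ KY (a - δ') * Real.exp (-(δ' * ρ y y₀)) := by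
  have key : ∀ y', Real.exp (-(a * ρ y y')) * Real.exp (-(b * ρ y' y₀)) ≤
      Real.exp (-(δ' * ρ y y₀)) * Real.exp (-((a - δ') * ρ y y')) := by
    intro y'
    rw [← Real.exp_add, ← Real.exp_add]
    apply Real.exp_le_exp.2
    have h1 := hρ.triangle y y' y₀
    have h2 := hρ.nonneg y y'
    have h3 := hρ.nonneg y' y₀
    nlinarith [mul_le_mul_of_nonneg_left h1 hδ'0, mul_nonneg (sub_nonneg.2 hδ'b) h3]
  calc ∑ y', Real.exp (-(a * ρ y y')) * Real.exp (-(b * ρ y' y₀))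
      ≤ ∑ y', Real.exp (-(δ' * ρ y y₀)) * Real.exp (-((a - δ') * ρ y y')) := Finset.sum_le_sum fun y' _ => key y'
    _ = Real.exp (-(δ' * ρ y y₀)) * ∑ y', Real.exp (-((a - δ') * ρ y y')) := by rw [Finset.mul_sum]
    _ ≤ Real.exp (-(δ' * ρ y y₀)) * KY (a - δ') :=
        mul_le_mul_of_nonneg_left (hK (a - δ') (by linarith) y) (Real.exp_pos _).le
    _ = KY (a - δ') * Real.exp (-(δ' * ρ y y₀)) := mul_comm _ _

/-! ## §2  Composition, sums, identity, monotonicity of block bounds -/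

/-- entries of a composite: `|(f∘g)(e_m)_i| ≤ Σ_k |f(e_k)_i|·|g(e_m)_k|`. [cite: Balaban1984PropagatorsII, Prop. 2.5 p.246 (composition bookkeeping, ours)] -/
theorem abs_comp_entry_le [DecidableEq μ] (f : EuclideanSpace ℝ κ →ₗ[ℝ] EuclideanSpace ℝ ι) (g : EuclideanSpace ℝ μ →ₗ[ℝ] EuclideanSpace ℝ κ) (m : μ) (i : ι) :
    |(f ∘ₗ g) (EuclideanSpace.single m (1 : ℝ)) i| ≤
      ∑ k, |f (EuclideanSpace.single k (1 : ℝ)) i| * |g (EuclideanSpace.single m (1 : ℝ)) k| := by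
  rw [LinearMap.comp_apply]
  exact abs_apply_le_sum f _ i

/-- **COMPOSITION OF BLOCK BOUNDS, NO VOLUME FACTOR**: block bounds `(C_f, a)` for `f : ℓ²(κ) → ℓ²(ι)` and `(C_g, b)` for `g : ℓ²(μ) → ℓ²(κ)`
give the block bound `(C_f·C_g·K(a − δ′), δ′)` for `f∘g`, for every `0 ≤ δ′ ≤ b`, `δ′ < a` — the sizes of the fibres of the middle carrier `κ`
do NOT enter. [cite: Balaban1984PropagatorsII, Prop. 2.5 p.246 (the undisplayed «(2.129) ⇒ (1.110)» composition step; statement and proof ours)] -/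
theorem blockBound_comp [Fintype Y] [DecidableEq Y] [Fintype μ] [DecidableEq μ] (hρ : IsPseudoDist ρ) (hK : SumBound ρ KY) (f : EuclideanSpace ℝ κ →ₗ[ℝ] EuclideanSpace ℝ ι)
    (g : EuclideanSpace ℝ μ →ₗ[ℝ] EuclideanSpace ℝ κ) (pι : ι → Y) (pκ : κ → Y) (pμ : μ → Y) {Cf Cg a b δ' : ℝ} (hCf : 0 ≤ Cf) (hCg : 0 ≤ Cg)
    (hδ'0 : 0 ≤ δ') (hδ'b : δ' ≤ b) (hδ'a : δ' < a)
    (hf : ∀ (i : ι) (y : Y), ∑ k ∈ univ.filter (fun k => pκ k = y), |f (EuclideanSpace.single k (1 : ℝ)) i| ≤ Cf * Real.exp (-(a * ρ (pι i) y)))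
    (hg : ∀ (k : κ) (y : Y), ∑ m ∈ univ.filter (fun m => pμ m = y), |g (EuclideanSpace.single m (1 : ℝ)) k| ≤ Cg * Real.exp (-(b * ρ (pκ k) y)))
    (i : ι) (y : Y) :
    ∑ m ∈ univ.filter (fun m => pμ m = y), |(f ∘ₗ g) (EuclideanSpace.single m (1 : ℝ)) i| ≤
      Cf * Cg * KY (a - δ') * Real.exp (-(δ' * ρ (pι i) y)) := by
  -- Σ_{m∈y} |(fg)_{im}| ≤ Σ_k |f_{ik}| Σ_{m∈y} |g_{km}|
  have h1 : ∑ m ∈ univ.filter (fun m => pμ m = y), |(f ∘ₗ g) (EuclideanSpace.single m (1 : ℝ)) i| ≤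
      ∑ k, |f (EuclideanSpace.single k (1 : ℝ)) i| *
        ∑ m ∈ univ.filter (fun m => pμ m = y), |g (EuclideanSpace.single m (1 : ℝ)) k| := by
    calc ∑ m ∈ univ.filter (fun m => pμ m = y), |(f ∘ₗ g) (EuclideanSpace.single m (1 : ℝ)) i|
        ≤ ∑ m ∈ univ.filter (fun m => pμ m = y), ∑ k, |f (EuclideanSpace.single k (1 : ℝ)) i| * |g (EuclideanSpace.single m (1 : ℝ)) k| :=
          Finset.sum_le_sum fun m _ => abs_comp_entry_le f g m i
      _ = _ := by rw [Finset.sum_comm]; exact Finset.sum_congr rfl fun k _ => by rw [Finset.mul_sum]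
  -- the block bound of `g`, then regroup the `k`-sum by the fibres of `pκ` and use the block bound of `f`
  have h2 : ∑ k, |f (EuclideanSpace.single k (1 : ℝ)) i| * ∑ m ∈ univ.filter (fun m => pμ m = y), |g (EuclideanSpace.single m (1 : ℝ)) k| ≤
      ∑ k, |f (EuclideanSpace.single k (1 : ℝ)) i| * (Cg * Real.exp (-(b * ρ (pκ k) y))) :=
    Finset.sum_le_sum fun k _ => mul_le_mul_of_nonneg_left (hg k y) (abs_nonneg _)
  have h3 : ∑ k, |f (EuclideanSpace.single k (1 : ℝ)) i| * (Cg * Real.exp (-(b * ρ (pκ k) y))) =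
      ∑ y', (∑ k ∈ univ.filter (fun k => pκ k = y'), |f (EuclideanSpace.single k (1 : ℝ)) i|) * (Cg * Real.exp (-(b * ρ y' y))) := by
    rw [← Finset.sum_fiberwise univ pκ (fun k => |f (EuclideanSpace.single k (1 : ℝ)) i| * (Cg * Real.exp (-(b * ρ (pκ k) y))))]
    refine Finset.sum_congr rfl fun y' _ => ?_
    rw [Finset.sum_mul]
    refine Finset.sum_congr rfl fun k hk => ?_
    rw [(Finset.mem_filter.mp hk).2]
  have h4 : ∑ y', (∑ k ∈ univ.filter (fun k => pκ k = y'), |f (EuclideanSpace.single k (1 : ℝ)) i|) * (Cg * Real.exp (-(b * ρ y' y))) ≤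
      ∑ y', Cf * Real.exp (-(a * ρ (pι i) y')) * (Cg * Real.exp (-(b * ρ y' y))) :=
    Finset.sum_le_sum fun y' _ => mul_le_mul_of_nonneg_right (hf i y') (by positivity)
  have h5 : ∑ y', Cf * Real.exp (-(a * ρ (pι i) y')) * (Cg * Real.exp (-(b * ρ y' y))) =
      Cf * Cg * ∑ y', Real.exp (-(a * ρ (pι i) y')) * Real.exp (-(b * ρ y' y)) := by
    rw [Finset.mul_sum]; exact Finset.sum_congr rfl fun y' _ => by ring
  have h6 := conv_exp_le_rate hρ hK hδ'0 hδ'b hδ'a (pι i) y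
  calc _ ≤ _ := h1
    _ ≤ _ := h2
    _ = _ := h3
    _ ≤ _ := h4
    _ = _ := h5
    _ ≤ Cf * Cg * (KY (a - δ') * Real.exp (-(δ' * ρ (pι i) y))) := mul_le_mul_of_nonneg_left h6 (mul_nonneg hCf hCg)
    _ = _ := by ring

/-- block bounds ADD: `(C_f, δ)` and `(C_g, δ)` give `(C_f + C_g, δ)` for `f + g`. [cite: Balaban1984PropagatorsII, Prop. 2.5 p.246 (composition bookkeeping, ours)] -/
theorem blockBound_add [DecidableEq Y] (f g : EuclideanSpace ℝ κ →ₗ[ℝ] EuclideanSpace ℝ ι) (pι : ι → Y) (pκ : κ → Y) {Cf Cg δ : ℝ}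
    (hf : ∀ (i : ι) (y : Y), ∑ k ∈ univ.filter (fun k => pκ k = y), |f (EuclideanSpace.single k (1 : ℝ)) i| ≤ Cf * Real.exp (-(δ * ρ (pι i) y)))
    (hg : ∀ (i : ι) (y : Y), ∑ k ∈ univ.filter (fun k => pκ k = y), |g (EuclideanSpace.single k (1 : ℝ)) i| ≤ Cg * Real.exp (-(δ * ρ (pι i) y)))
    (i : ι) (y : Y) :
    ∑ k ∈ univ.filter (fun k => pκ k = y), |(f + g) (EuclideanSpace.single k (1 : ℝ)) i| ≤ (Cf + Cg) * Real.exp (-(δ * ρ (pι i) y)) := by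
  calc ∑ k ∈ univ.filter (fun k => pκ k = y), |(f + g) (EuclideanSpace.single k (1 : ℝ)) i|
      ≤ ∑ k ∈ univ.filter (fun k => pκ k = y), (|f (EuclideanSpace.single k (1 : ℝ)) i| + |g (EuclideanSpace.single k (1 : ℝ)) i|) :=
        Finset.sum_le_sum fun k _ => by
          rw [LinearMap.add_apply, PiLp.add_apply]
          exact abs_add_le _ _
    _ ≤ _ := by rw [Finset.sum_add_distrib, add_mul]; exact add_le_add (hf i y) (hg i y)

/-- block bounds SUBTRACT: `(C_f + C_g, δ)` for `f − g`. [cite: Balaban1984PropagatorsII, Prop. 2.5 p.246 (composition bookkeeping, ours)] -/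
theorem blockBound_sub [DecidableEq Y] (f g : EuclideanSpace ℝ κ →ₗ[ℝ] EuclideanSpace ℝ ι) (pι : ι → Y) (pκ : κ → Y) {Cf Cg δ : ℝ}
    (hf : ∀ (i : ι) (y : Y), ∑ k ∈ univ.filter (fun k => pκ k = y), |f (EuclideanSpace.single k (1 : ℝ)) i| ≤ Cf * Real.exp (-(δ * ρ (pι i) y)))
    (hg : ∀ (i : ι) (y : Y), ∑ k ∈ univ.filter (fun k => pκ k = y), |g (EuclideanSpace.single k (1 : ℝ)) i| ≤ Cg * Real.exp (-(δ * ρ (pι i) y)))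
    (i : ι) (y : Y) :
    ∑ k ∈ univ.filter (fun k => pκ k = y), |(f - g) (EuclideanSpace.single k (1 : ℝ)) i| ≤ (Cf + Cg) * Real.exp (-(δ * ρ (pι i) y)) := by
  calc ∑ k ∈ univ.filter (fun k => pκ k = y), |(f - g) (EuclideanSpace.single k (1 : ℝ)) i|
      ≤ ∑ k ∈ univ.filter (fun k => pκ k = y), (|f (EuclideanSpace.single k (1 : ℝ)) i| + |g (EuclideanSpace.single k (1 : ℝ)) i|) :=
        Finset.sum_le_sum fun k _ => by
          rw [LinearMap.sub_apply, PiLp.sub_apply]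
          exact abs_sub _ _
    _ ≤ _ := by rw [Finset.sum_add_distrib, add_mul]; exact add_le_add (hf i y) (hg i y)

/-- block bounds SCALE: `(|c|·C_f, δ)` for `c·f`. [cite: Balaban1984PropagatorsII, Prop. 2.5 p.246 (composition bookkeeping, ours)] -/
theorem blockBound_smul [DecidableEq Y] (f : EuclideanSpace ℝ κ →ₗ[ℝ] EuclideanSpace ℝ ι) (pι : ι → Y) (pκ : κ → Y) {Cf δ : ℝ} (c : ℝ)
    (hf : ∀ (i : ι) (y : Y), ∑ k ∈ univ.filter (fun k => pκ k = y), |f (EuclideanSpace.single k (1 : ℝ)) i| ≤ Cf * Real.exp (-(δ * ρ (pι i) y)))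
    (i : ι) (y : Y) :
    ∑ k ∈ univ.filter (fun k => pκ k = y), |(c • f) (EuclideanSpace.single k (1 : ℝ)) i| ≤ |c| * Cf * Real.exp (-(δ * ρ (pι i) y)) := by
  calc ∑ k ∈ univ.filter (fun k => pκ k = y), |(c • f) (EuclideanSpace.single k (1 : ℝ)) i|
      = |c| * ∑ k ∈ univ.filter (fun k => pκ k = y), |f (EuclideanSpace.single k (1 : ℝ)) i| := by
        rw [Finset.mul_sum]
        refine Finset.sum_congr rfl fun k _ => ?_
        rw [LinearMap.smul_apply, PiLp.smul_apply, smul_eq_mul, abs_mul]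
    _ ≤ |c| * (Cf * Real.exp (-(δ * ρ (pι i) y))) := mul_le_mul_of_nonneg_left (hf i y) (abs_nonneg c)
    _ = _ := by ring

/-- the IDENTITY has the block bound `(1, δ)` for every `δ` (its only entry in the fibre of `y` is at `i` itself, when `pι i = y`).
[cite: Balaban1984PropagatorsII, Prop. 2.5 p.246 (composition bookkeeping, ours)] -/
theorem blockBound_id [DecidableEq Y] [Fintype ι] [DecidableEq ι] (hρ : IsPseudoDist ρ) (pι : ι → Y) (δ : ℝ) (i : ι) (y : Y) :
    ∑ k ∈ univ.filter (fun k => pι k = y), |(LinearMap.id : EuclideanSpace ℝ ι →ₗ[ℝ] EuclideanSpace ℝ ι) (EuclideanSpace.single k (1 : ℝ)) i| ≤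
      1 * Real.exp (-(δ * ρ (pι i) y)) := by
  by_cases hy : pι i = y
  · have h : ∑ k ∈ univ.filter (fun k => pι k = y), |(LinearMap.id : EuclideanSpace ℝ ι →ₗ[ℝ] EuclideanSpace ℝ ι)
        (EuclideanSpace.single k (1 : ℝ)) i| ≤ ∑ k, |(EuclideanSpace.single k (1 : ℝ) : EuclideanSpace ℝ ι) i| :=
      Finset.sum_le_sum_of_subset_of_nonneg (Finset.filter_subset _ _) fun _ _ _ => abs_nonneg _
    refine h.trans ?_
    rw [← hy, hρ.zero, mul_zero, neg_zero, Real.exp_zero, mul_one]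
    rw [Finset.sum_eq_single i (fun k _ hk => by rw [PiLp.single_apply, if_neg (Ne.symm hk), abs_zero])
      (fun h => absurd (Finset.mem_univ i) h)]
    rw [PiLp.single_apply, if_pos rfl, abs_one]
  · have h0 : ∑ k ∈ univ.filter (fun k => pι k = y), |(LinearMap.id : EuclideanSpace ℝ ι →ₗ[ℝ] EuclideanSpace ℝ ι)
        (EuclideanSpace.single k (1 : ℝ)) i| = 0 := by
      refine Finset.sum_eq_zero fun k hk => ?_
      have hk' : pι k = y := (Finset.mem_filter.mp hk).2
      have hne : i ≠ k := fun h => hy (h ▸ hk')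
      rw [LinearMap.id_apply, PiLp.single_apply, if_neg hne, abs_zero]
    rw [h0]; positivity

/-- block bounds are MONOTONE in the constant and ANTITONE in the rate. [cite: Balaban1984PropagatorsII, Prop. 2.5 p.246 (composition bookkeeping, ours)] -/
theorem blockBound_mono [DecidableEq Y] (hρ : IsPseudoDist ρ) (f : EuclideanSpace ℝ κ →ₗ[ℝ] EuclideanSpace ℝ ι) (pι : ι → Y) (pκ : κ → Y) {C C' δ δ' : ℝ}
    (hC' : 0 ≤ C') (hCC : C ≤ C') (hδδ : δ' ≤ δ)
    (hf : ∀ (i : ι) (y : Y), ∑ k ∈ univ.filter (fun k => pκ k = y), |f (EuclideanSpace.single k (1 : ℝ)) i| ≤ C * Real.exp (-(δ * ρ (pι i) y)))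
    (i : ι) (y : Y) :
    ∑ k ∈ univ.filter (fun k => pκ k = y), |f (EuclideanSpace.single k (1 : ℝ)) i| ≤ C' * Real.exp (-(δ' * ρ (pι i) y)) := by
  refine (hf i y).trans ?_
  have h1 : Real.exp (-(δ * ρ (pι i) y)) ≤ Real.exp (-(δ' * ρ (pι i) y)) :=
    Real.exp_le_exp.2 (by nlinarith [hρ.nonneg (pι i) y])
  exact (mul_le_mul_of_nonneg_right hCC (Real.exp_pos _).le).trans (mul_le_mul_of_nonneg_left h1 hC')

/-! ## §3  Entry decay with bounded fibres ⇒ block bounds; adjoints -/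

/-- **entry decay ⇒ block bound**: `|f(e_k)_i| ≤ Ae^{−δρ(pι i, pκ k)}` and fibres of `pκ` of size `≤ N` give the block bound `(A·N, δ)`.
[cite: Balaban1984PropagatorsII, Prop. 2.5 p.246 (composition bookkeeping, ours)] -/
theorem blockBound_of_entry [DecidableEq Y] (f : EuclideanSpace ℝ κ →ₗ[ℝ] EuclideanSpace ℝ ι) (pι : ι → Y) (pκ : κ → Y) {A δ : ℝ} {N : ℕ} (hA : 0 ≤ A)
    (hN : ∀ y, (univ.filter fun k => pκ k = y).card ≤ N)
    (hf : ∀ (i : ι) (k : κ), |f (EuclideanSpace.single k (1 : ℝ)) i| ≤ A * Real.exp (-(δ * ρ (pι i) (pκ k)))) (i : ι) (y : Y) :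
    ∑ k ∈ univ.filter (fun k => pκ k = y), |f (EuclideanSpace.single k (1 : ℝ)) i| ≤ A * N * Real.exp (-(δ * ρ (pι i) y)) := by
  calc ∑ k ∈ univ.filter (fun k => pκ k = y), |f (EuclideanSpace.single k (1 : ℝ)) i|
      ≤ ∑ k ∈ univ.filter (fun k => pκ k = y), A * Real.exp (-(δ * ρ (pι i) y)) :=
        Finset.sum_le_sum fun k hk => by rw [← (Finset.mem_filter.mp hk).2]; exact hf i k
    _ = (univ.filter fun k => pκ k = y).card * (A * Real.exp (-(δ * ρ (pι i) y))) := by rw [Finset.sum_const, nsmul_eq_mul]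
    _ ≤ N * (A * Real.exp (-(δ * ρ (pι i) y))) := mul_le_mul_of_nonneg_right (by exact_mod_cast hN y) (by positivity)
    _ = _ := by ring

/-- **the entries of the adjoint are the transposed entries**: `f*(e_i)_k = f(e_k)_i`. [cite: Balaban1984PropagatorsI, (1.21) p.21 (ℓ² adjoint; ours)] -/
theorem adjoint_entry [Fintype ι] [DecidableEq ι] (f : EuclideanSpace ℝ κ →ₗ[ℝ] EuclideanSpace ℝ ι) (i : ι) (k : κ) :
    LinearMap.adjoint f (EuclideanSpace.single i (1 : ℝ)) k = f (EuclideanSpace.single k (1 : ℝ)) i := by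
  have h1 : LinearMap.adjoint f (EuclideanSpace.single i (1 : ℝ)) k =
      ⟪EuclideanSpace.single k (1 : ℝ), LinearMap.adjoint f (EuclideanSpace.single i (1 : ℝ))⟫_ℝ := by
    rw [EuclideanSpace.inner_single_left, map_one, one_mul]
  rw [h1, LinearMap.adjoint_inner_right, EuclideanSpace.inner_single_right, one_mul]
  rfl

/-- **entry decay ⇒ block bound for the ADJOINT** (block COLUMN sums of `f`): `|f(e_k)_i| ≤ Ae^{−δρ(pι i, pκ k)}` and fibres of `pι` of size
`≤ N` give the block bound `(A·N, δ)` for `f*`. [cite: Balaban1984PropagatorsII, Prop. 2.5 p.246 (composition bookkeeping, ours)] -/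
theorem blockBound_adjoint_of_entry [DecidableEq Y] [Fintype ι] [DecidableEq ι] (hρ : IsPseudoDist ρ) (f : EuclideanSpace ℝ κ →ₗ[ℝ] EuclideanSpace ℝ ι) (pι : ι → Y) (pκ : κ → Y)
    {A δ : ℝ} {N : ℕ} (hA : 0 ≤ A) (hN : ∀ y, (univ.filter fun i => pι i = y).card ≤ N)
    (hf : ∀ (i : ι) (k : κ), |f (EuclideanSpace.single k (1 : ℝ)) i| ≤ A * Real.exp (-(δ * ρ (pι i) (pκ k)))) (k : κ) (y : Y) :
    ∑ i ∈ univ.filter (fun i => pι i = y), |LinearMap.adjoint f (EuclideanSpace.single i (1 : ℝ)) k| ≤ A * N * Real.exp (-(δ * ρ (pκ k) y)) :=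
  blockBound_of_entry (LinearMap.adjoint f) pκ pι hA hN (fun k i => by rw [adjoint_entry, hρ.symm]; exact hf i k) k y

/-! ## §4  The printed shape of (1.110): cube-sup bounds ⇔ block bounds -/

/-- the number of lattice points within `r` of a point is at most `e^r·K(1)`. [cite: Balaban1984PropagatorsI, (1.115) p.36 (lattice sums; ours)] -/
theorem card_ball_le [Fintype Y] (hρ : IsPseudoDist ρ) (hK : SumBound ρ KY) (y' : Y) (r : ℝ) :
    ((univ.filter fun y => ρ y y' ≤ r).card : ℝ) ≤ Real.exp r * KY 1 := by
  calc ((univ.filter fun y => ρ y y' ≤ r).card : ℝ) = ∑ y ∈ univ.filter (fun y => ρ y y' ≤ r), (1 : ℝ) := by simp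
    _ ≤ ∑ y ∈ univ.filter (fun y => ρ y y' ≤ r), Real.exp r * Real.exp (-(1 * ρ y' y)) :=
        Finset.sum_le_sum fun y hy => by
          have h : ρ y y' ≤ r := (Finset.mem_filter.mp hy).2
          rw [← Real.exp_add, hρ.symm y' y]
          exact Real.one_le_exp (by linarith)
    _ ≤ ∑ y, Real.exp r * Real.exp (-(1 * ρ y' y)) :=
        Finset.sum_le_sum_of_subset_of_nonneg (Finset.filter_subset _ _) fun _ _ _ => by positivity
    _ = Real.exp r * ∑ y, Real.exp (-(1 * ρ y' y)) := by rw [Finset.mul_sum]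
    _ ≤ Real.exp r * KY 1 := mul_le_mul_of_nonneg_left (hK 1 one_pos y') (Real.exp_pos _).le

/-- **BLOCK BOUND ⇒ THE SHAPE OF (1.110)**: if `f` has the block bound `(C, δ)` (`C, δ ≥ 0`), `x` is supported over the points within `r`
of `y′` and `|x_k| ≤ X`, then at every `i` whose position is within `r` of `y`,
`|(fx)_i| ≤ C·K(1)e^{(1+2δ)r}·e^{−δρ(y,y′)}·X`. [cite: Balaban1984PropagatorsI, (1.110) p.35 (shape; derivation ours)] -/
theorem abs_apply_le_of_support [Fintype Y] [DecidableEq Y] (hρ : IsPseudoDist ρ) (hK : SumBound ρ KY) (f : EuclideanSpace ℝ κ →ₗ[ℝ] EuclideanSpace ℝ ι)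
    (pι : ι → Y) (pκ : κ → Y) {C δ r X : ℝ} (hC : 0 ≤ C) (hδ : 0 ≤ δ) (hX : 0 ≤ X)
    (hf : ∀ (i : ι) (y : Y), ∑ k ∈ univ.filter (fun k => pκ k = y), |f (EuclideanSpace.single k (1 : ℝ)) i| ≤ C * Real.exp (-(δ * ρ (pι i) y)))
    (x : EuclideanSpace ℝ κ) (y y' : Y) (hsupp : ∀ k, x k ≠ 0 → ρ (pκ k) y' ≤ r) (hx : ∀ k, |x k| ≤ X) (i : ι) (hi : ρ (pι i) y ≤ r) :
    |f x i| ≤ C * (KY 1 * Real.exp ((1 + 2 * δ) * r)) * Real.exp (-(δ * ρ y y')) * X := by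
  -- block profile of `x`: `X` on the `r`-ball of `y′`, `0` elsewhere
  set g : Y → ℝ := fun z => if ρ z y' ≤ r then X else 0 with hg
  have hg0 : ∀ z, 0 ≤ g z := fun z => by
    simp only [hg]
    split_ifs
    · exact hX
    · exact le_rfl
  have hxg : ∀ k, |x k| ≤ g (pκ k) := fun k => by
    by_cases hk : x k = 0
    · rw [hk, abs_zero]; exact hg0 _
    · simp only [hg, if_pos (hsupp k hk)]; exact hx k
  have h1 := abs_apply_le_of_blockBound f pι pκ hf x g hg0 hxg i
  -- `e^{−δρ(pι i, z)} ≤ e^{2δr}e^{−δρ(y,y′)}` on the ball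
  have hball : ∀ z, ρ z y' ≤ r → Real.exp (-(δ * ρ (pι i) z)) ≤ Real.exp (2 * δ * r) * Real.exp (-(δ * ρ y y')) := by
    intro z hz
    rw [← Real.exp_add]
    apply Real.exp_le_exp.2
    have t1 := hρ.triangle y (pι i) y'
    have t2 := hρ.triangle (pι i) z y'
    rw [hρ.symm y (pι i)] at t1
    nlinarith [mul_le_mul_of_nonneg_left t1 hδ, mul_le_mul_of_nonneg_left t2 hδ]
  have h2 : ∑ z, Real.exp (-(δ * ρ (pι i) z)) * g z ≤
      ∑ z ∈ univ.filter (fun z => ρ z y' ≤ r), Real.exp (2 * δ * r) * Real.exp (-(δ * ρ y y')) * X := by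
    rw [← Finset.sum_filter_add_sum_filter_not univ (fun z => ρ z y' ≤ r)]
    have hz : ∑ z ∈ univ.filter (fun z => ¬ ρ z y' ≤ r), Real.exp (-(δ * ρ (pι i) z)) * g z = 0 :=
      Finset.sum_eq_zero fun z hz => by simp only [hg, if_neg (Finset.mem_filter.mp hz).2, mul_zero]
    rw [hz, add_zero]
    refine Finset.sum_le_sum fun z hz => ?_
    have hz' : ρ z y' ≤ r := (Finset.mem_filter.mp hz).2
    simp only [hg, if_pos hz']
    exact mul_le_mul_of_nonneg_right (hball z hz') hX
  have h3 : ∑ z ∈ univ.filter (fun z => ρ z y' ≤ r), Real.exp (2 * δ * r) * Real.exp (-(δ * ρ y y')) * X ≤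
      Real.exp r * KY 1 * (Real.exp (2 * δ * r) * Real.exp (-(δ * ρ y y')) * X) := by
    rw [Finset.sum_const, nsmul_eq_mul]
    exact mul_le_mul_of_nonneg_right (card_ball_le hρ hK y' r) (by positivity)
  calc |f x i| ≤ C * ∑ z, Real.exp (-(δ * ρ (pι i) z)) * g z := h1
    _ ≤ C * (Real.exp r * KY 1 * (Real.exp (2 * δ * r) * Real.exp (-(δ * ρ y y')) * X)) := mul_le_mul_of_nonneg_left (h2.trans h3) hC
    _ = C * (KY 1 * Real.exp ((1 + 2 * δ) * r)) * Real.exp (-(δ * ρ y y')) * X := by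
        have : Real.exp ((1 + 2 * δ) * r) = Real.exp r * Real.exp (2 * δ * r) := by rw [← Real.exp_add]; ring_nf
        rw [this]; ring

/-- **THE SHAPE OF (1.110) ⇒ BLOCK BOUND**: if for all `x` supported over the `r`-ball of `y′` with `|x| ≤ X` and all `i` over the `r`-ball of
`y` one has `|(fx)_i| ≤ Ce^{−δρ(y,y′)}X` (`r ≥ 0`), then `f` has the block bound `(C, δ)` — tested on the sign vector of the `i`-th row
restricted to the fibre of `y′`. [cite: Balaban1984PropagatorsI, (1.110) p.35 (shape; derivation ours)] -/
theorem blockBound_of_cubeSup [DecidableEq Y] (hρ : IsPseudoDist ρ) (f : EuclideanSpace ℝ κ →ₗ[ℝ] EuclideanSpace ℝ ι) (pι : ι → Y) (pκ : κ → Y)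
    {C δ r : ℝ} (hr : 0 ≤ r)
    (h : ∀ (x : EuclideanSpace ℝ κ) (X : ℝ) (y y' : Y), 0 ≤ X → (∀ k, x k ≠ 0 → ρ (pκ k) y' ≤ r) → (∀ k, |x k| ≤ X) →
      ∀ i : ι, ρ (pι i) y ≤ r → |f x i| ≤ C * Real.exp (-(δ * ρ y y')) * X)
    (i : ι) (y' : Y) :
    ∑ k ∈ univ.filter (fun k => pκ k = y'), |f (EuclideanSpace.single k (1 : ℝ)) i| ≤ C * Real.exp (-(δ * ρ (pι i) y')) := by
  -- the test vector
  set x : EuclideanSpace ℝ κ := WithLp.toLp 2 (fun k => if pκ k = y' then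
    (if 0 ≤ f (EuclideanSpace.single k (1 : ℝ)) i then (1 : ℝ) else -1) else 0) with hxdef
  have hxk : ∀ k, x k = if pκ k = y' then (if 0 ≤ f (EuclideanSpace.single k (1 : ℝ)) i then (1 : ℝ) else -1) else 0 := fun k => rfl
  have hsupp : ∀ k, x k ≠ 0 → ρ (pκ k) y' ≤ r := by
    intro k hk
    rw [hxk] at hk
    by_cases hk' : pκ k = y'
    · rw [hk', hρ.zero]; exact hr
    · exact absurd (if_neg hk') hk
  have hX : ∀ k, |x k| ≤ 1 := fun k => by
    rw [hxk]; split_ifs <;> simp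
  have hfx : f x i = ∑ k ∈ univ.filter (fun k => pκ k = y'), |f (EuclideanSpace.single k (1 : ℝ)) i| := by
    rw [apply_eq_sum_entry, ← Finset.sum_filter_add_sum_filter_not univ (fun k => pκ k = y')]
    have hz : ∑ k ∈ univ.filter (fun k => ¬ pκ k = y'), f (EuclideanSpace.single k (1 : ℝ)) i * x k = 0 :=
      Finset.sum_eq_zero fun k hk => by rw [hxk, if_neg (Finset.mem_filter.mp hk).2, mul_zero]
    rw [hz, add_zero]
    refine Finset.sum_congr rfl fun k hk => ?_
    rw [hxk, if_pos (Finset.mem_filter.mp hk).2]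
    split_ifs with hs
    · rw [mul_one, abs_of_nonneg hs]
    · rw [mul_neg, mul_one, abs_of_neg (lt_of_not_ge hs)]
  have key := h x 1 (pι i) y' zero_le_one hsupp hX i (by rw [hρ.zero]; exact hr)
  rw [hfx, mul_one] at key
  have habs : abs (∑ k ∈ univ.filter (fun k => pκ k = y'), |f (EuclideanSpace.single k (1 : ℝ)) i|) =
      ∑ k ∈ univ.filter (fun k => pκ k = y'), |f (EuclideanSpace.single k (1 : ℝ)) i| :=
    abs_of_nonneg (Finset.sum_nonneg fun _ _ => abs_nonneg _)
  rwa [habs] at key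

/-- **block bound ⇒ global sup bound** (the p. 36 remark *"The localized inequalities (1.110)–(1.114) imply immediately the following global
inequalities"*): `|(fx)_i| ≤ C·K(δ)·X` whenever `|x| ≤ X` (`δ > 0`). [cite: Balaban1984PropagatorsI, (1.115) p.36 (global from local; derivation ours)] -/
theorem abs_apply_le_global [Fintype Y] [DecidableEq Y] (hK : SumBound ρ KY) (f : EuclideanSpace ℝ κ →ₗ[ℝ] EuclideanSpace ℝ ι) (pι : ι → Y) (pκ : κ → Y)
    {C δ X : ℝ} (hC : 0 ≤ C) (hδ : 0 < δ) (hX : 0 ≤ X)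
    (hf : ∀ (i : ι) (y : Y), ∑ k ∈ univ.filter (fun k => pκ k = y), |f (EuclideanSpace.single k (1 : ℝ)) i| ≤ C * Real.exp (-(δ * ρ (pι i) y)))
    (x : EuclideanSpace ℝ κ) (hx : ∀ k, |x k| ≤ X) (i : ι) : |f x i| ≤ C * KY δ * X := by
  have h1 := abs_apply_le_of_blockBound f pι pκ hf x (fun _ => X) (fun _ => hX) hx i
  have h2 : ∑ y, Real.exp (-(δ * ρ (pι i) y)) * X ≤ KY δ * X := by
    rw [← Finset.sum_mul]; exact mul_le_mul_of_nonneg_right (hK δ hδ (pι i)) hX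
  exact h1.trans (by rw [mul_assoc]; exact mul_le_mul_of_nonneg_left h2 hC)

end Abstract

/-! ## §5  The unit-torus instance of record: `(T^{(j)}, |·−·|_T)` with the uniform profile `K_{d+1}` -/

section Torus

variable {d : ℕ} (M : Fin (d + 1) → ℕ) [hM : ∀ μ, NeZero (M μ)]

/-- the torus sup-distance `|rep t − rep t′|_T` on the unit torus `T^{(j)} = Tor M` is a pseudo-distance. [cite: Balaban1984PropagatorsI, (1.29) p.23 (torus distance; ours)] -/
theorem torusDist_isPseudoDist : IsPseudoDist (fun t t' : Tor M => torusSupNorm M (rep M t - rep M t')) where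
  symm t t' := by
    show torusSupNorm M (rep M t - rep M t') = torusSupNorm M (rep M t' - rep M t)
    rw [← torusSupNorm_neg M, neg_sub]
  zero t := by
    show torusSupNorm M (rep M t - rep M t) = 0
    rw [sub_self, torusSupNorm_zero]
  triangle t t' t'' := torusSupNorm_sub_le M _ _ _

/-- the unit torus has the UNIFORM lattice-sum profile `K_{d+1}(a)` (b05's `sum_exp_torusSupNorm_sub_rep_le`), independently of the period vector.
[cite: Balaban1984PropagatorsI, (1.115) p.36 (lattice sums; ours)] -/
theorem torusDist_sumBound : SumBound (fun t t' : Tor M => torusSupNorm M (rep M t - rep M t')) (fun a => latticeConst (d + 1) a) :=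
  fun _ ha t => sum_exp_torusSupNorm_sub_rep_le M ha (rep M t)

end Torus

end Literature.MathematicalPhysics.QuantumFieldTheory.Balaban1983to89.B6BlockDecayCalculus

end
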